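import Summits.BirchSwinnertonDyer.BirchSwinnertonDyer.Theses.ThetaPartnerAtTwo
import Summits.BirchSwinnertonDyer.BirchSwinnertonDyer.Theorems.ThetaPartnerAtTwoSignedTransportAtTwoBridgeResidual
import Summits.BirchSwinnertonDyer.BirchSwinnertonDyer.Theorems.ThetaPartnerAtTwoSignedTransportAtTwoBridgeSelmer
import Summits.BirchSwinnertonDyer.BirchSwinnertonDyer.Theorems.ThetaPartnerAtTwoSignedTransportAtTwoBridgeOriented
import HarnessLib

/-!
# Crux `SignedTransportAtTwo` (stmt-BirchSwinnertonDyer-20333, route `ThetaPartnerAtTwo`): the ORIENTED compositions at the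
# residual / Selmer-group level — fin2 + Kλ2 + R-A ⇒ crux (the `--glue-by` of the staged rev-17 split) and
# sel2 + Kλ2 + R-A ⇒ crux (the composition of skeleton `bridge` v8)
# (lead prover bsd-wall-tp2-p1 g3; `--supports stmt-BirchSwinnertonDyer-20333`; closes nothing)

HONEST FRAMING. THEOREMS ONLY; every research input is an explicit hypothesis spelled inline; nothing about any curve is
asserted; BSD is not proved by any of this. Two one-line compositions through `signedTransportAtTwo_of_gvBinders_mazurTateR`
(`…BridgeOriented.lean`), `muTorsion2_of_fin2` (p530437) and `fin2_of_sel2` (p535022). The analytic binder is the ORIENTED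
Mazur–Tate congruence R-A (`eulerFactorProductInv`, director W-13 (b)); the as-typed constant-unit text of v5–v7 is
numerically refuted (census g10 V2MT-FALSIFIER-RUN1; planner p2 g7 V2MT-ORIENTATION-AT2-v1.3) and is no longer composed.

References: [GreenbergVatsal2000] Thm. (1.4), Prop. (2.8), Thm. (1.6); [BDKim2009] Prop. 2.10, Cor. 2.13; [Vatsal1999]
Thm. (1.10); [Kobayashi2003] Def. 1.1, Conjecture (p. 2).
-/

set_option autoImplicit false
-- D-0017: single-problem summit, so `Summit.BirchSwinnertonDyer.BirchSwinnertonDyer.…` repeats a namespace BY DESIGN.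
set_option linter.dupNamespace false

noncomputable section

open scoped Classical MatrixGroups ModularForm BigOperators

open CongruenceSubgroup Polynomial WeierstrassCurve NumberField IsDedekindDomain Rat.HeightOneSpectrum
  Literature Literature.NumberTheory.EllipticCurves Literature.NumberTheory.EllipticCurves.IwasawaAlgebra
  Literature.NumberTheory.EllipticCurves.ModularForms
  Literature.NumberTheory.EllipticCurves.Rank1Residual
  Literature.NumberTheory.EllipticCurves.Kobayashi2003 ZpExtension
  Literature.NumberTheory.EllipticCurves.GreenbergVatsal2000
  Literature.NumberTheory.EllipticCurves.Sprung2017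
  Summit.BirchSwinnertonDyer.Rank1Residual.X1.MuLambda
  Summit.BirchSwinnertonDyer.Rank1Residual.Supersingular
  Summit.BirchSwinnertonDyer.Rank1Residual.X2.EulerFactorInvariants
  Summit.BirchSwinnertonDyer.BirchSwinnertonDyer.Theorems.TwoAdicTwistConverse

namespace Summit.BirchSwinnertonDyer.BirchSwinnertonDyer.Theorems.SignedTransportAtTwo

/-- **ORIENTED COMPOSITION at the residual level** (= bridge v6's `signedTransportAtTwo_of_gvBinders_residual` with the oriented analytic binder):
stub_fin2 + stub_lam2d + R-A ⇒ `SignedTransportAtTwo` BY NAME. This is the `SignedTransportAtTwo_of` of a v7 skeleton whose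
stubs are stub_fin2 / stub_lam2d VERBATIM (v6) and stub_V2mt := `MazurTateCongruenceAtTwoR` (g7/Sketch17b.lean).
[cite: GreenbergVatsal2000, §1 pp. 8–9, Thm. (1.4), Thm. (1.6)] [cite: Vatsal1999, Thm. (1.10)] -/
theorem signedTransportAtTwo_of_gvBinders_residualR
    (hfin2 :
    ∀ (W : WeierstrassCurve ℚ) [W.IsElliptic] [W.IsGloballyMinimal] (A : WeierstrassCurve ℚ) [A.IsElliptic]
      [A.IsGloballyMinimal], ¬ W.HasCM → W.analyticRank = 0 → GoodSS W 2 → W.frobeniusTrace 2 = 0 →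
      A.HasCM → GoodSS A 2 → A.frobeniusTrace 2 = 0 →
    (∃ e : WeierstrassCurve.geomTorsion W (2 : ℤ) ≃+ WeierstrassCurve.geomTorsion A (2 : ℤ),
      ∀ (σ : Field.absoluteGaloisGroup ℚ) (P : WeierstrassCurve.geomTorsion W (2 : ℤ)), e (σ • P) = σ • e P) →
    ∀ (κ : ZpExtension ℚ 2) (γ : Field.absoluteGaloisGroup ℚ), κ.IsCyclotomic → κ.IsTopGenerator γ →
    ∀ (D : SignedSelmerDualData W κ γ 1) (D' : SignedSelmerDualData A κ γ 1)
      [Module.Finite (IwasawaAlgebra 2) D.X] [Module.Finite (IwasawaAlgebra 2) D'.X],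
      Finite (D'.X ⧸ (augIdealP 2 • ⊤ : Submodule (IwasawaAlgebra 2) D'.X)) →
      Finite (D.X ⧸ (augIdealP 2 • ⊤ : Submodule (IwasawaAlgebra 2) D.X)))
    (hlam2 :
    ∀ (W : WeierstrassCurve ℚ) [W.IsElliptic] [W.IsGloballyMinimal] (A : WeierstrassCurve ℚ) [A.IsElliptic]
      [A.IsGloballyMinimal], ¬ W.HasCM → W.analyticRank = 0 → GoodSS W 2 → W.frobeniusTrace 2 = 0 →
      A.HasCM → GoodSS A 2 → A.frobeniusTrace 2 = 0 →
    (∃ e : WeierstrassCurve.geomTorsion W (2 : ℤ) ≃+ WeierstrassCurve.geomTorsion A (2 : ℤ),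
      ∀ (σ : Field.absoluteGaloisGroup ℚ) (P : WeierstrassCurve.geomTorsion W (2 : ℤ)), e (σ • P) = σ • e P) →
    ∀ (κ : ZpExtension ℚ 2) (γ : Field.absoluteGaloisGroup ℚ), κ.IsCyclotomic → κ.IsTopGenerator γ →
    ∀ (S₀ : Finset (HeightOneSpectrum (𝓞 ℚ))), (∀ v ∈ S₀, ((2 : ℕ) : 𝓞 ℚ) ∉ v.asIdeal) →
      (∀ v : HeightOneSpectrum (𝓞 ℚ), ¬ W.HasGoodReductionAt v → v ∈ S₀) →
      (∀ v : HeightOneSpectrum (𝓞 ℚ), ¬ A.HasGoodReductionAt v → v ∈ S₀) →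
    ∀ (D : SignedSelmerDualData W κ γ 1) (D' : SignedSelmerDualData A κ γ 1)
      [Module.Finite (IwasawaAlgebra 2) D.X] [Module.Finite (IwasawaAlgebra 2) D'.X],
      Module.IsTorsion (IwasawaAlgebra 2) D.X → Module.IsTorsion (IwasawaAlgebra 2) D'.X → D.mu = 0 → D'.mu = 0 →
      lambdaInvariant 2 D.X +
          ∑ v ∈ S₀, 2 ^ padicValNat 2 ((Rat.HeightOneSpectrum.natGenerator v ^ 2 - 1) / 8) * dMultiplicity W 2 v =
        lambdaInvariant 2 D'.X +
          ∑ v ∈ S₀, 2 ^ padicValNat 2 ((Rat.HeightOneSpectrum.natGenerator v ^ 2 - 1) / 8) * dMultiplicity A 2 v)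
    (hV2mtR :
    ∀ (W : WeierstrassCurve ℚ) [W.IsElliptic] [W.IsGloballyMinimal] (A : WeierstrassCurve ℚ) [A.IsElliptic]
      [A.IsGloballyMinimal], ¬ W.HasCM → W.analyticRank = 0 → GoodSS W 2 → W.frobeniusTrace 2 = 0 →
      A.HasCM → GoodSS A 2 → A.frobeniusTrace 2 = 0 →
    (∃ e : WeierstrassCurve.geomTorsion W (2 : ℤ) ≃+ WeierstrassCurve.geomTorsion A (2 : ℤ),
      ∀ (σ : Field.absoluteGaloisGroup ℚ) (P : WeierstrassCurve.geomTorsion W (2 : ℤ)), e (σ • P) = σ • e P) →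
    ∀ (γ : Field.absoluteGaloisGroup ℚ), IsCyclotomicVariable 2 γ →
    ∀ [NeZero (W.conductorNorm ℤ)] (f : CuspForm (Gamma0 (W.conductorNorm ℤ)) 2), IsNewformOf W f →
    ∀ (ϖ : ℚ), (ϖ : ℝ) * W.realPeriodRat = plusPeriod f →
    ∀ (Lplus Lminus : IwasawaAlgebra 2), IsPollackPair f 2 Lplus Lminus →
    ∀ [NeZero (A.conductorNorm ℤ)] (fA : CuspForm (Gamma0 (A.conductorNorm ℤ)) 2), IsNewformOf A fA →
    ∀ (ϖA : ℚ), (ϖA : ℝ) * A.realPeriodRat = plusPeriod fA →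
    ∀ (LplusA LminusA : IwasawaAlgebra 2), IsPollackPair fA 2 LplusA LminusA →
    ∀ (S₀ : Finset (HeightOneSpectrum (𝓞 ℚ))), (∀ v ∈ S₀, ((2 : ℕ) : 𝓞 ℚ) ∉ v.asIdeal) →
      (∀ v : HeightOneSpectrum (𝓞 ℚ), ¬ W.HasGoodReductionAt v → v ∈ S₀) →
      (∀ v : HeightOneSpectrum (𝓞 ℚ), ¬ A.HasGoodReductionAt v → v ∈ S₀) →
    ∀ (G : IwasawaAlgebra 2) (m : ℕ), iwasawaToPowerSeries 2 G =
        PowerSeries.C ((2 : ℚ_[2]) ^ m * (ϖ : ℚ_[2])) * iwasawaToPowerSeries 2 (kobayashiL 1 Lplus Lminus) →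
    ∀ (GA : IwasawaAlgebra 2) (m' : ℕ), iwasawaToPowerSeries 2 GA =
        PowerSeries.C ((2 : ℚ_[2]) ^ m' * (ϖA : ℚ_[2])) * iwasawaToPowerSeries 2 (kobayashiL 1 LplusA LminusA) →
    ∃ u : ℤ_[2]ˣ, ∀ n : ℕ, Even n → ∃ q r : IwasawaAlgebra 2,
      PowerSeries.C (((2 : ℤ_[2]) ^ m' : ℤ_[2]) : ℚ_[2]) *
          (PowerSeries.C ((2 : ℚ_[2]) ^ m * (ϖ : ℚ_[2])) *
            ((mazurTateElement f 2 n).map (algebraMap ℚ ℚ_[2]) : PowerSeries ℚ_[2]) *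
            iwasawaToPowerSeries 2 (eulerFactorProductInv W 2 S₀)) -
        PowerSeries.C (((u : ℤ_[2]) * (2 : ℤ_[2]) ^ m : ℤ_[2]) : ℚ_[2]) *
          (PowerSeries.C ((2 : ℚ_[2]) ^ m' * (ϖA : ℚ_[2])) *
            ((mazurTateElement fA 2 n).map (algebraMap ℚ ℚ_[2]) : PowerSeries ℚ_[2]) *
            iwasawaToPowerSeries 2 (eulerFactorProductInv A 2 S₀)) =
      iwasawaToPowerSeries 2
        (PowerSeries.C ((2 : ℤ_[2]) ^ (m + m' + 1)) * q + toIwasawa 2 (cyclotomicOmega 2 n) * r)) :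
    Summit.BirchSwinnertonDyer.BirchSwinnertonDyer.Theses.ThetaPartnerAtTwo.SignedTransportAtTwo :=
  signedTransportAtTwo_of_gvBinders_mazurTateR (muTorsion2_of_fin2 hfin2) hlam2 hV2mtR

/-- **ORIENTED v8 COMPOSITION** (= `signedTransportAtTwo_of_gvBinders_selmer`, p537180, with the oriented analytic binder):
the crux `SignedTransportAtTwo` BY NAME from the Selmer-group-level transfer sel2 (`hsel2`: `Sel⁺(A/ℚ_∞)[2]` finite ⇒
`Sel⁺(W/ℚ_∞)[2]` finite along `W[2] ≅ A[2]`, for every cyclotomic `κ`), Kλ2 at `2` (`hlam2`) and R-A (`hV2mtR` =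
`MazurTateCongruenceAtTwoR`). This is the `SignedTransportAtTwo_of` of skeleton `bridge` v8 (stubs stub_sel2 / stub_lam2d /
stub_V2mtR). Nothing asserted beyond the binders.
[cite: GreenbergVatsal2000, Thm. (1.4), Prop. (2.8), Thm. (1.6)] [cite: BDKim2009, Prop. 2.10, Cor. 2.13]
[cite: Vatsal1999, Thm. (1.10)] [cite: Kobayashi2003, Def. 1.1, Conjecture (p. 2)] -/
theorem signedTransportAtTwo_of_gvBinders_selmerR
    (hsel2 :
    ∀ (W : WeierstrassCurve ℚ) [W.IsElliptic] [W.IsGloballyMinimal] (A : WeierstrassCurve ℚ) [A.IsElliptic]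
      [A.IsGloballyMinimal], ¬ W.HasCM → W.analyticRank = 0 → GoodSS W 2 → W.frobeniusTrace 2 = 0 →
      A.HasCM → GoodSS A 2 → A.frobeniusTrace 2 = 0 →
    (∃ e : WeierstrassCurve.geomTorsion W (2 : ℤ) ≃+ WeierstrassCurve.geomTorsion A (2 : ℤ),
      ∀ (σ : Field.absoluteGaloisGroup ℚ) (P : WeierstrassCurve.geomTorsion W (2 : ℤ)), e (σ • P) = σ • e P) →
    ∀ (κ : ZpExtension ℚ 2), κ.IsCyclotomic →
      {s : signedSelmerInfty A κ 1 | (2 : ℕ) • s = 0}.Finite →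
      {s : signedSelmerInfty W κ 1 | (2 : ℕ) • s = 0}.Finite)
    (hlam2 :
    ∀ (W : WeierstrassCurve ℚ) [W.IsElliptic] [W.IsGloballyMinimal] (A : WeierstrassCurve ℚ) [A.IsElliptic]
      [A.IsGloballyMinimal], ¬ W.HasCM → W.analyticRank = 0 → GoodSS W 2 → W.frobeniusTrace 2 = 0 →
      A.HasCM → GoodSS A 2 → A.frobeniusTrace 2 = 0 →
    (∃ e : WeierstrassCurve.geomTorsion W (2 : ℤ) ≃+ WeierstrassCurve.geomTorsion A (2 : ℤ),
      ∀ (σ : Field.absoluteGaloisGroup ℚ) (P : WeierstrassCurve.geomTorsion W (2 : ℤ)), e (σ • P) = σ • e P) →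
    ∀ (κ : ZpExtension ℚ 2) (γ : Field.absoluteGaloisGroup ℚ), κ.IsCyclotomic → κ.IsTopGenerator γ →
    ∀ (S₀ : Finset (HeightOneSpectrum (𝓞 ℚ))), (∀ v ∈ S₀, ((2 : ℕ) : 𝓞 ℚ) ∉ v.asIdeal) →
      (∀ v : HeightOneSpectrum (𝓞 ℚ), ¬ W.HasGoodReductionAt v → v ∈ S₀) →
      (∀ v : HeightOneSpectrum (𝓞 ℚ), ¬ A.HasGoodReductionAt v → v ∈ S₀) →
    ∀ (D : SignedSelmerDualData W κ γ 1) (D' : SignedSelmerDualData A κ γ 1)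
      [Module.Finite (IwasawaAlgebra 2) D.X] [Module.Finite (IwasawaAlgebra 2) D'.X],
      Module.IsTorsion (IwasawaAlgebra 2) D.X → Module.IsTorsion (IwasawaAlgebra 2) D'.X → D.mu = 0 → D'.mu = 0 →
      lambdaInvariant 2 D.X +
          ∑ v ∈ S₀, 2 ^ padicValNat 2 ((Rat.HeightOneSpectrum.natGenerator v ^ 2 - 1) / 8) * dMultiplicity W 2 v =
        lambdaInvariant 2 D'.X +
          ∑ v ∈ S₀, 2 ^ padicValNat 2 ((Rat.HeightOneSpectrum.natGenerator v ^ 2 - 1) / 8) * dMultiplicity A 2 v)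
    (hV2mtR :
    ∀ (W : WeierstrassCurve ℚ) [W.IsElliptic] [W.IsGloballyMinimal] (A : WeierstrassCurve ℚ) [A.IsElliptic]
      [A.IsGloballyMinimal], ¬ W.HasCM → W.analyticRank = 0 → GoodSS W 2 → W.frobeniusTrace 2 = 0 →
      A.HasCM → GoodSS A 2 → A.frobeniusTrace 2 = 0 →
    (∃ e : WeierstrassCurve.geomTorsion W (2 : ℤ) ≃+ WeierstrassCurve.geomTorsion A (2 : ℤ),
      ∀ (σ : Field.absoluteGaloisGroup ℚ) (P : WeierstrassCurve.geomTorsion W (2 : ℤ)), e (σ • P) = σ • e P) →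
    ∀ (γ : Field.absoluteGaloisGroup ℚ), IsCyclotomicVariable 2 γ →
    ∀ [NeZero (W.conductorNorm ℤ)] (f : CuspForm (Gamma0 (W.conductorNorm ℤ)) 2), IsNewformOf W f →
    ∀ (ϖ : ℚ), (ϖ : ℝ) * W.realPeriodRat = plusPeriod f →
    ∀ (Lplus Lminus : IwasawaAlgebra 2), IsPollackPair f 2 Lplus Lminus →
    ∀ [NeZero (A.conductorNorm ℤ)] (fA : CuspForm (Gamma0 (A.conductorNorm ℤ)) 2), IsNewformOf A fA →
    ∀ (ϖA : ℚ), (ϖA : ℝ) * A.realPeriodRat = plusPeriod fA →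
    ∀ (LplusA LminusA : IwasawaAlgebra 2), IsPollackPair fA 2 LplusA LminusA →
    ∀ (S₀ : Finset (HeightOneSpectrum (𝓞 ℚ))), (∀ v ∈ S₀, ((2 : ℕ) : 𝓞 ℚ) ∉ v.asIdeal) →
      (∀ v : HeightOneSpectrum (𝓞 ℚ), ¬ W.HasGoodReductionAt v → v ∈ S₀) →
      (∀ v : HeightOneSpectrum (𝓞 ℚ), ¬ A.HasGoodReductionAt v → v ∈ S₀) →
    ∀ (G : IwasawaAlgebra 2) (m : ℕ), iwasawaToPowerSeries 2 G =
        PowerSeries.C ((2 : ℚ_[2]) ^ m * (ϖ : ℚ_[2])) * iwasawaToPowerSeries 2 (kobayashiL 1 Lplus Lminus) →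
    ∀ (GA : IwasawaAlgebra 2) (m' : ℕ), iwasawaToPowerSeries 2 GA =
        PowerSeries.C ((2 : ℚ_[2]) ^ m' * (ϖA : ℚ_[2])) * iwasawaToPowerSeries 2 (kobayashiL 1 LplusA LminusA) →
    ∃ u : ℤ_[2]ˣ, ∀ n : ℕ, Even n → ∃ q r : IwasawaAlgebra 2,
      PowerSeries.C (((2 : ℤ_[2]) ^ m' : ℤ_[2]) : ℚ_[2]) *
          (PowerSeries.C ((2 : ℚ_[2]) ^ m * (ϖ : ℚ_[2])) *
            ((mazurTateElement f 2 n).map (algebraMap ℚ ℚ_[2]) : PowerSeries ℚ_[2]) *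
            iwasawaToPowerSeries 2 (eulerFactorProductInv W 2 S₀)) -
        PowerSeries.C (((u : ℤ_[2]) * (2 : ℤ_[2]) ^ m : ℤ_[2]) : ℚ_[2]) *
          (PowerSeries.C ((2 : ℚ_[2]) ^ m' * (ϖA : ℚ_[2])) *
            ((mazurTateElement fA 2 n).map (algebraMap ℚ ℚ_[2]) : PowerSeries ℚ_[2]) *
            iwasawaToPowerSeries 2 (eulerFactorProductInv A 2 S₀)) =
      iwasawaToPowerSeries 2
        (PowerSeries.C ((2 : ℤ_[2]) ^ (m + m' + 1)) * q + toIwasawa 2 (cyclotomicOmega 2 n) * r)) :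
    Summit.BirchSwinnertonDyer.BirchSwinnertonDyer.Theses.ThetaPartnerAtTwo.SignedTransportAtTwo :=
  signedTransportAtTwo_of_gvBinders_residualR (fin2_of_sel2 hsel2) hlam2 hV2mtR

end Summit.BirchSwinnertonDyer.BirchSwinnertonDyer.Theorems.SignedTransportAtTwo

end
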